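import Summits.BirchSwinnertonDyer.BirchSwinnertonDyer.Theorems.AlignedTransportAtTwoMainConjectureOfRankZeroBSDAtTwoCubicOffStratumFukudaIndex
import HarnessLib

/-!
# Route `AlignedTransportAtTwo`, crux C2 `MainConjectureOfRankZeroBSDAtTwo` (stmt-BirchSwinnertonDyer-22298):
# THE CUBIC CLASS-GROUP DOORS INTO `MC₂(W)` WITHOUT A RAMIFICATION BIT — Chevalley's door OFF the stratum (uniform on `Δ_min ≢ 1 (mod 8)`) and the
# layer-pair doors (class number / `2`-rank) at ANY pair `(n, n+1)`, `n ≥ 0`, on EVERY stratum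

HONEST FRAMING (cell `bsd-f1-sign2`, WIDTH-5 attached prover seat `bsd-line-att-p5` gen 28 on line `birth` of the lead `bsd-line-att-p2`;
`--supports` stmt-BirchSwinnertonDyer-22298, closes nothing; BSD is NOT proved by any of this; the crux C2, its verdict «blocked-on
`Rank1Residual.GreenbergMuConjectureIrreducible`» and every registered stub are untouched). THEOREMS ONLY — no definition, no named fact,
no `sorry`. With `TotallyRamifiedFrom κ 0` a tree theorem for the cubic `2`-torsion field of every good-ordinary curve with `E(ℚ)[2] = 0`
(`…CubicOffStratumFukudaIndex.totallyRamifiedFrom_zero_adjoin_of_isOrdinaryAt_two`, att-p5 g28), the cubic class-group doors into `MC₂(W)` shed their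
ramification inputs:

* **`classicalMuVanishes_adjoin_of_chevalley_of_not_onKilfordStratumAtTwo`** / **`mazurMainConjecture_two_of_muIneqRel_of_chevalley_of_not_onKilfordStratumAtTwo`**
  (+ `…_of_minimalDiscriminantInt_emod_eight_ne_one`): att-p5 g26's OFF-stratum Chevalley door (p748062) WITHOUT its displayed bit «every prime of `ℚ(β)`
  above `2` has odd index» (true only on `Δ_min ≡ 5 (8)`, g27): PRINT⁵ + MuIneqʳ (registered stub verbatim) + cell hypotheses (`Δ_W < 0`) + OFF the stratum +
  TWO displayed bits of `ℚ(β)` only — `h(ℚ(β))` odd and a unit `ε ≠ a² − 2b²` — ⟹ `MC₂(W)`, now UNIFORMLY on `Δ_min ≡ 3, 5, 7 (mod 8)`.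
* **`mazurMainConjecture_two_of_muIneqRel_of_classNumberPExp_succ_eq`**, **`mazurMainConjecture_two_of_muIneqRel_of_classGroupPRank_succ_eq`**:
  PRINT⁵ + MuIneqʳ + cell hypotheses + per cyclotomic `ℤ₂`-extension of `ℚ(β)` ONE layer pair `(n, n+1)`, ANY `n ≥ 0`, with equal `2`-class-number
  exponent (resp. equal `2`-rank) ⟹ `MC₂(W)` — att-p4 g24's `…CubicRankDoorLayerOne` (`1 ≤ n`) extended to the pair `(0, 1)`, every stratum.

CONDITIONAL theorems (PRINT⁵, MuIneqʳ displayed); nothing is asserted about any curve's class groups; nothing is closed; BSD is not proved.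

References: [Fukuda1994] Thm. 1 (1)(2), p. 264; [Lang1990] Ch. 13 §4, Lemma 4.1; [Washington1997] §13.1 Lemma 13.3; [Kato2004Asterisque] Thm. 17.4 (1)(2)
(p. 273); [GreenbergLNM1716] Thm. 4.1 (p. 102), Conj. 1.11 (p. 58); [Iwasawa1973MuInvariants] Thm. 2/3; tree p748062, att-p4 g24 `…CubicRankDoorLayerOne`,
att-p5 g24 `…CubicCarrierRoad`.
-/

set_option linter.dupNamespace false
set_option autoImplicit false

noncomputable section

open scoped Classical NumberField nonZeroDivisors

namespace Summit.BirchSwinnertonDyer.BirchSwinnertonDyer.Theorems.AlignedTransportAtTwoCubicOffStratumFukudaIndexDoors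

open NumberField IsDedekindDomain Polynomial WeierstrassCurve IntermediateField CongruenceSubgroup
  Literature.NumberTheory.IwasawaTheory Literature.NumberTheory.GaloisRepresentations
  Literature.NumberTheory.EllipticCurves Literature.NumberTheory.EllipticCurves.Greenberg1999
  Literature.NumberTheory.EllipticCurves.ModularForms
  Literature.NumberTheory.EllipticCurves.Rank1Residual
  Literature.NumberTheory.EllipticCurves.Module
  Summit.BirchSwinnertonDyer.Rank1Residual
  Summit.BirchSwinnertonDyer.Rank1Residual.X1.MuLambda
  Summit.BirchSwinnertonDyer.Rank1Residual.X5
  Summit.BirchSwinnertonDyer.Rank1Residual.F1Sign2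
  Summit.BirchSwinnertonDyer.BirchSwinnertonDyer.Theorems.Rank1ResidualX1Defs
  Summit.BirchSwinnertonDyer.BirchSwinnertonDyer.Theses.AlignedTransportAtTwo
  Summit.BirchSwinnertonDyer.BirchSwinnertonDyer.Theorems.AlignedTransportAtTwoKilfordStratumShared
  Summit.BirchSwinnertonDyer.BirchSwinnertonDyer.Theorems.AlignedTransportAtTwoCubicCarrierRoad
  Summit.BirchSwinnertonDyer.BirchSwinnertonDyer.Theorems.AlignedTransportAtTwoCubicOffStratumPrimes
  Summit.BirchSwinnertonDyer.BirchSwinnertonDyer.Theorems.AlignedTransportAtTwoCubicOffStratumFukudaIndex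

variable (W : WeierstrassCurve ℚ) [W.IsElliptic]

/-! ## §1 Chevalley's door OFF the stratum, no ramification bit -/

/-- **`μ₂(ℚ(β)^{cyc}) = 0` OFF THE STRATUM BY CHEVALLEY'S DOOR — NO RAMIFICATION BIT.** `W/ℚ` globally minimal, good ordinary at `2`, no rational
`2`-torsion abscissa, OFF the Kilford stratum, `β ∈ ℚ̄` a root of the `2`-division cubic; displayed: `h(ℚ(β))` odd and a unit `ε` of `𝓞 ℚ(β)` not of the form
`a² − 2b²`. Then every cyclotomic `ℤ₂`-extension of `ℚ(β)` has `μ = 0`: `e₀ = 0` (`h` odd), `e₁ = 0` (bsd-2adic's Chevalley lemma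
`classNumberPExp_one_eq_zero_of_nonNorm_unit_two`: odd degree, at most two primes above `2` — att-p5 g26 —, non-norm unit), Fukuda's index `0`
(att-p5 g28 `totallyRamifiedFrom_zero_adjoin_of_isOrdinaryAt_two`), Fukuda Thm. 1 (1). p748062's door had in addition «every prime above `2` of odd index»,
unsatisfiable on `Δ_min ≡ 3, 7 (8)` (g27). [cite: Lang1990, Ch. 13 §4, Lemma 4.1] [cite: Fukuda1994, Thm. 1 (1), p. 264] [cite: Washington1997, §13.1 Lemma 13.3] -/
theorem classicalMuVanishes_adjoin_of_chevalley_of_not_onKilfordStratumAtTwo [W.IsGloballyMinimal] (hord : IsOrdinaryAt W 2)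
    (ht : ∀ x : ℚ, ¬ HasRationalTwoTorsionX W x) (hs : ¬ OnKilfordStratumAtTwo W)
    {β : AlgebraicClosure ℚ} (hβ : aeval β W.twoTorsionPolynomial.toPoly = 0)
    (hh : haveI : FiniteDimensional ℚ ↥(IntermediateField.adjoin ℚ ({β} : Set (AlgebraicClosure ℚ))) :=
        IntermediateField.adjoin.finiteDimensional ((AlgebraicClosure.isAlgebraic ℚ).isAlgebraic β).isIntegral
      haveI : NumberField ↥(IntermediateField.adjoin ℚ ({β} : Set (AlgebraicClosure ℚ))) := NumberField.mk
      ¬ 2 ∣ classNumber ↥(IntermediateField.adjoin ℚ ({β} : Set (AlgebraicClosure ℚ))))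
    {ε : 𝓞 ↥(IntermediateField.adjoin ℚ ({β} : Set (AlgebraicClosure ℚ)))} (hεu : IsUnit ε)
    (hnn : ∀ a b : ↥(IntermediateField.adjoin ℚ ({β} : Set (AlgebraicClosure ℚ))),
      (ε : ↥(IntermediateField.adjoin ℚ ({β} : Set (AlgebraicClosure ℚ)))) ≠ a ^ 2 - 2 * b ^ 2)
    (κP : ZpExtension ↥(IntermediateField.adjoin ℚ ({β} : Set (AlgebraicClosure ℚ))) 2) (hκP : κP.IsCyclotomic) :
    ClassicalMuVanishes κP := by
  have hirr := AlignedTransportAtTwoSeed.irr_two_of_forall_not_hasRationalTwoTorsionX W ht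
  have hβint : IsIntegral ℚ β := ((AlgebraicClosure.isAlgebraic ℚ).isAlgebraic β).isIntegral
  haveI : FiniteDimensional ℚ ↥(IntermediateField.adjoin ℚ ({β} : Set (AlgebraicClosure ℚ))) :=
    IntermediateField.adjoin.finiteDimensional hβint
  haveI : NumberField ↥(IntermediateField.adjoin ℚ ({β} : Set (AlgebraicClosure ℚ))) := NumberField.mk
  have h3 : Module.finrank ℚ ↥(IntermediateField.adjoin ℚ ({β} : Set (AlgebraicClosure ℚ))) = 3 :=
    AddKatoTwo.finrank_adjoin_root_twoTorsionPolynomial_eq_three W hirr hβ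
  have hodd3 : ¬ 2 ∣ Module.finrank ℚ ↥(IntermediateField.adjoin ℚ ({β} : Set (AlgebraicClosure ℚ))) := by rw [h3]; decide
  have hs2 := ncard_adjoin_le_two_of_not_onKilfordStratumAtTwo W ht hs hβ
  have h1 : classNumberPExp κP 1 = 0 :=
    AddKatoTwo.classNumberPExp_one_eq_zero_of_nonNorm_unit_two hodd3 κP hκP hh hs2 hεu hnn
  have hh' : ¬ 2 ∣ Nat.card (ClassGroup (𝓞 ↥(IntermediateField.adjoin ℚ ({β} : Set (AlgebraicClosure ℚ))))) := by
    rwa [NumberField.classNumber, ← Nat.card_eq_fintype_card] at hh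
  have h0 : classNumberPExp κP 0 = 0 := AddKatoTwo.classNumberPExp_zero_eq_zero_of_odd_classNumber _ hh' κP
  exact classicalMuVanishes_adjoin_of_classNumberPExp_succ_eq W hord ht hβ κP hκP (n := 0) (by rw [h1, h0])

variable [W.IsGloballyMinimal]

/-- **THE OFF-STRATUM DOOR INTO `MC₂(W)` BY CHEVALLEY, NO RAMIFICATION BIT.** PRINT⁵ {Kato 17.4 (1)(2) at `2` (`h17`), Greenberg 4.1 (`hGr`), period unit
(`hper`), modularity (`hmod`), GZK (`hGZK`)} + MuIneqʳ (`hI`, the registered stub VERBATIM) + the cell hypotheses (good ordinary at `2`, no rational `2`-torsion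
abscissa, `Δ_W < 0`, `r_an = 0`, analytic `μ₂ = 0` on the even branch, `BSD₂(W)`) + OFF the Kilford stratum + `β` a root of the `2`-division cubic + TWO displayed
bits of `ℚ(β)` (`h(ℚ(β))` odd, a unit `ε ≠ a² − 2b²`) ⟹ `MC₂(W)` (att-p5 g24's cubic carrier ∘ §1). Uniform on `Δ_min ≡ 3, 5, 7 (mod 8)`.
[cite: Fukuda1994, Thm. 1 (1), p. 264] [cite: Kato2004Asterisque, Thm. 17.4 (1)(2) (p. 273)] [cite: GreenbergLNM1716, Thm. 4.1 (p. 102) and Conj. 1.11 (p. 58)]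
[cite: Iwasawa1973MuInvariants, Thm. 2 and Thm. 3] [cite: Lang1990, Ch. 13 §4, Lemma 4.1] -/
theorem mazurMainConjecture_two_of_muIneqRel_of_chevalley_of_not_onKilfordStratumAtTwo
    (h17 : ∀ [NeZero (W.conductorNorm ℤ)] (f : CuspForm (Gamma0 (W.conductorNorm ℤ)) 2),
      kato_divisibility_allPrimes W 2 (f := f))
    (hGr : Greenberg1999.thm41_charValue_rankZero_anyPrime)
    (hper : realPeriodRat_eq_unit_mul_plusPeriod_two) (hmod : nonempty_modularParametrizationData)
    (hGZK : rank_eq_analyticRank_of_analyticRank_le_one)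
    (hI : ∀ (W : WeierstrassCurve ℚ) [W.IsElliptic] [W.IsGloballyMinimal], IsOrdinaryAt W 2 →
      (∀ x : ℚ, ¬ HasRationalTwoTorsionX W x) →
      ∀ (κ : ZpExtension ℚ 2) (γ : Field.absoluteGaloisGroup ℚ), κ.IsCyclotomic →
      κ.IsTopGenerator γ → IsCyclotomicVariable 2 γ →
      ∀ ⦃N : ℕ⦄ [NeZero N] (f : CuspForm (Gamma0 N) 2), IsNewformOf W f →
      ∀ Gp : IwasawaAlgebra 2, iwasawaToPowerSeries 2 Gp = padicLFunction f (unitRoot W 2 : ℚ_[2]) →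
      ∀ (D : W.SelmerDualData κ γ) (Yr : W.FineSelmerDualDataRelaxedInf κ γ),
        lengthAt (IwasawaAlgebra 2) D.X ⟨IwasawaAlgebra.augIdealP 2, IwasawaAlgebra.isPrime_augIdealP_holds 2⟩ ≤
          lengthAt (IwasawaAlgebra 2) (IwasawaAlgebra 2 ⧸ Ideal.span {Gp})
              ⟨IwasawaAlgebra.augIdealP 2, IwasawaAlgebra.isPrime_augIdealP_holds 2⟩ +
            lengthAt (IwasawaAlgebra 2) Yr.X ⟨IwasawaAlgebra.augIdealP 2, IwasawaAlgebra.isPrime_augIdealP_holds 2⟩)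
    (hord : IsOrdinaryAt W 2) (ht : ∀ x : ℚ, ¬ HasRationalTwoTorsionX W x) (hΔ : W.Δ < 0) (hr : W.analyticRank = 0)
    (hμan : ∀ ⦃N : ℕ⦄ [NeZero N] (f : CuspForm (Gamma0 N) 2), IsNewformOf W f →
      ∀ G : IwasawaAlgebra 2, IsEvenBranchLiftAtTwo W f G → red G ≠ 0)
    (hbsd : BSDp W 2) (hs : ¬ OnKilfordStratumAtTwo W)
    {β : AlgebraicClosure ℚ} (hβ : aeval β W.twoTorsionPolynomial.toPoly = 0)
    (hh : haveI : FiniteDimensional ℚ ↥(IntermediateField.adjoin ℚ ({β} : Set (AlgebraicClosure ℚ))) :=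
        IntermediateField.adjoin.finiteDimensional ((AlgebraicClosure.isAlgebraic ℚ).isAlgebraic β).isIntegral
      haveI : NumberField ↥(IntermediateField.adjoin ℚ ({β} : Set (AlgebraicClosure ℚ))) := NumberField.mk
      ¬ 2 ∣ classNumber ↥(IntermediateField.adjoin ℚ ({β} : Set (AlgebraicClosure ℚ))))
    {ε : 𝓞 ↥(IntermediateField.adjoin ℚ ({β} : Set (AlgebraicClosure ℚ)))} (hεu : IsUnit ε)
    (hnn : ∀ a b : ↥(IntermediateField.adjoin ℚ ({β} : Set (AlgebraicClosure ℚ))),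
      (ε : ↥(IntermediateField.adjoin ℚ ({β} : Set (AlgebraicClosure ℚ)))) ≠ a ^ 2 - 2 * b ^ 2) :
    MazurMainConjecture W 2 :=
  mazurMainConjecture_two_of_muIneqRel_of_classicalMu_cubicField_of_Δ_neg W h17 hGr hper hmod hGZK hI hord ht hΔ hr hμan hbsd hβ
    fun κP hκP => classicalMuVanishes_adjoin_of_chevalley_of_not_onKilfordStratumAtTwo W hord ht hs hβ hh hεu hnn κP hκP

/-- **THE OFF-STRATUM DOOR BY CHEVALLEY, decidable form**: the same with `Δ_min(W) % 8 ≠ 1` in place of «OFF the Kilford stratum» (tree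
`not_onKilfordStratumAtTwo_iff_minimalDiscriminantInt_emod_eight_ne`). [cite: Serre1973, Ch. II §3.3 Thm. 4] [cite: Fukuda1994, Thm. 1 (1), p. 264]
[cite: Kato2004Asterisque, Thm. 17.4 (1)(2) (p. 273)] [cite: Lang1990, Ch. 13 §4, Lemma 4.1] -/
theorem mazurMainConjecture_two_of_muIneqRel_of_chevalley_of_minimalDiscriminantInt_emod_eight_ne_one
    (h17 : ∀ [NeZero (W.conductorNorm ℤ)] (f : CuspForm (Gamma0 (W.conductorNorm ℤ)) 2),
      kato_divisibility_allPrimes W 2 (f := f))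
    (hGr : Greenberg1999.thm41_charValue_rankZero_anyPrime)
    (hper : realPeriodRat_eq_unit_mul_plusPeriod_two) (hmod : nonempty_modularParametrizationData)
    (hGZK : rank_eq_analyticRank_of_analyticRank_le_one)
    (hI : ∀ (W : WeierstrassCurve ℚ) [W.IsElliptic] [W.IsGloballyMinimal], IsOrdinaryAt W 2 →
      (∀ x : ℚ, ¬ HasRationalTwoTorsionX W x) →
      ∀ (κ : ZpExtension ℚ 2) (γ : Field.absoluteGaloisGroup ℚ), κ.IsCyclotomic →
      κ.IsTopGenerator γ → IsCyclotomicVariable 2 γ →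
      ∀ ⦃N : ℕ⦄ [NeZero N] (f : CuspForm (Gamma0 N) 2), IsNewformOf W f →
      ∀ Gp : IwasawaAlgebra 2, iwasawaToPowerSeries 2 Gp = padicLFunction f (unitRoot W 2 : ℚ_[2]) →
      ∀ (D : W.SelmerDualData κ γ) (Yr : W.FineSelmerDualDataRelaxedInf κ γ),
        lengthAt (IwasawaAlgebra 2) D.X ⟨IwasawaAlgebra.augIdealP 2, IwasawaAlgebra.isPrime_augIdealP_holds 2⟩ ≤
          lengthAt (IwasawaAlgebra 2) (IwasawaAlgebra 2 ⧸ Ideal.span {Gp})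
              ⟨IwasawaAlgebra.augIdealP 2, IwasawaAlgebra.isPrime_augIdealP_holds 2⟩ +
            lengthAt (IwasawaAlgebra 2) Yr.X ⟨IwasawaAlgebra.augIdealP 2, IwasawaAlgebra.isPrime_augIdealP_holds 2⟩)
    (hord : IsOrdinaryAt W 2) (ht : ∀ x : ℚ, ¬ HasRationalTwoTorsionX W x) (hΔ : W.Δ < 0) (hr : W.analyticRank = 0)
    (hμan : ∀ ⦃N : ℕ⦄ [NeZero N] (f : CuspForm (Gamma0 N) 2), IsNewformOf W f →
      ∀ G : IwasawaAlgebra 2, IsEvenBranchLiftAtTwo W f G → red G ≠ 0)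
    (hbsd : BSDp W 2) (h8 : minimalDiscriminantInt W % 8 ≠ 1)
    {β : AlgebraicClosure ℚ} (hβ : aeval β W.twoTorsionPolynomial.toPoly = 0)
    (hh : haveI : FiniteDimensional ℚ ↥(IntermediateField.adjoin ℚ ({β} : Set (AlgebraicClosure ℚ))) :=
        IntermediateField.adjoin.finiteDimensional ((AlgebraicClosure.isAlgebraic ℚ).isAlgebraic β).isIntegral
      haveI : NumberField ↥(IntermediateField.adjoin ℚ ({β} : Set (AlgebraicClosure ℚ))) := NumberField.mk
      ¬ 2 ∣ classNumber ↥(IntermediateField.adjoin ℚ ({β} : Set (AlgebraicClosure ℚ))))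
    {ε : 𝓞 ↥(IntermediateField.adjoin ℚ ({β} : Set (AlgebraicClosure ℚ)))} (hεu : IsUnit ε)
    (hnn : ∀ a b : ↥(IntermediateField.adjoin ℚ ({β} : Set (AlgebraicClosure ℚ))),
      (ε : ↥(IntermediateField.adjoin ℚ ({β} : Set (AlgebraicClosure ℚ)))) ≠ a ^ 2 - 2 * b ^ 2) :
    MazurMainConjecture W 2 :=
  mazurMainConjecture_two_of_muIneqRel_of_chevalley_of_not_onKilfordStratumAtTwo W h17 hGr hper hmod hGZK hI hord ht hΔ hr hμan hbsd
    ((not_onKilfordStratumAtTwo_iff_minimalDiscriminantInt_emod_eight_ne W hord).mpr h8) hβ hh hεu hnn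

/-! ## §2 The layer-pair doors at ANY pair `(n, n+1)`, every stratum -/

/-- **THE CLASS-NUMBER DOOR INTO `MC₂(W)` AT ANY LAYER PAIR.** PRINT⁵ + MuIneqʳ (registered stub verbatim) + cell hypotheses (`Δ_W < 0`) + `β` a root of the
`2`-division cubic + per cyclotomic `ℤ₂`-extension `κP` of `ℚ(β)`: ONE pair of consecutive layers `(n, n+1)`, ANY `n ≥ 0`, with `ord₂ h(ℚ(β)_{n+1}) = ord₂ h(ℚ(β)_n)`
⟹ `MC₂(W)`. No condition on `Δ_min mod 8`, no ramification bit. [cite: Fukuda1994, Thm. 1 (1), p. 264] [cite: Kato2004Asterisque, Thm. 17.4 (1)(2) (p. 273)]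
[cite: GreenbergLNM1716, Thm. 4.1 (p. 102) and Conj. 1.11 (p. 58)] [cite: Iwasawa1973MuInvariants, Thm. 2 and Thm. 3] -/
theorem mazurMainConjecture_two_of_muIneqRel_of_classNumberPExp_succ_eq
    (h17 : ∀ [NeZero (W.conductorNorm ℤ)] (f : CuspForm (Gamma0 (W.conductorNorm ℤ)) 2),
      kato_divisibility_allPrimes W 2 (f := f))
    (hGr : Greenberg1999.thm41_charValue_rankZero_anyPrime)
    (hper : realPeriodRat_eq_unit_mul_plusPeriod_two) (hmod : nonempty_modularParametrizationData)
    (hGZK : rank_eq_analyticRank_of_analyticRank_le_one)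
    (hI : ∀ (W : WeierstrassCurve ℚ) [W.IsElliptic] [W.IsGloballyMinimal], IsOrdinaryAt W 2 →
      (∀ x : ℚ, ¬ HasRationalTwoTorsionX W x) →
      ∀ (κ : ZpExtension ℚ 2) (γ : Field.absoluteGaloisGroup ℚ), κ.IsCyclotomic →
      κ.IsTopGenerator γ → IsCyclotomicVariable 2 γ →
      ∀ ⦃N : ℕ⦄ [NeZero N] (f : CuspForm (Gamma0 N) 2), IsNewformOf W f →
      ∀ Gp : IwasawaAlgebra 2, iwasawaToPowerSeries 2 Gp = padicLFunction f (unitRoot W 2 : ℚ_[2]) →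
      ∀ (D : W.SelmerDualData κ γ) (Yr : W.FineSelmerDualDataRelaxedInf κ γ),
        lengthAt (IwasawaAlgebra 2) D.X ⟨IwasawaAlgebra.augIdealP 2, IwasawaAlgebra.isPrime_augIdealP_holds 2⟩ ≤
          lengthAt (IwasawaAlgebra 2) (IwasawaAlgebra 2 ⧸ Ideal.span {Gp})
              ⟨IwasawaAlgebra.augIdealP 2, IwasawaAlgebra.isPrime_augIdealP_holds 2⟩ +
            lengthAt (IwasawaAlgebra 2) Yr.X ⟨IwasawaAlgebra.augIdealP 2, IwasawaAlgebra.isPrime_augIdealP_holds 2⟩)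
    (hord : IsOrdinaryAt W 2) (ht : ∀ x : ℚ, ¬ HasRationalTwoTorsionX W x) (hΔ : W.Δ < 0) (hr : W.analyticRank = 0)
    (hμan : ∀ ⦃N : ℕ⦄ [NeZero N] (f : CuspForm (Gamma0 N) 2), IsNewformOf W f →
      ∀ G : IwasawaAlgebra 2, IsEvenBranchLiftAtTwo W f G → red G ≠ 0)
    (hbsd : BSDp W 2)
    {β : AlgebraicClosure ℚ} (hβ : aeval β W.twoTorsionPolynomial.toPoly = 0)
    (hcert : ∀ κP : ZpExtension ↥(IntermediateField.adjoin ℚ ({β} : Set (AlgebraicClosure ℚ))) 2, κP.IsCyclotomic →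
      ∃ n : ℕ, classNumberPExp κP (n + 1) = classNumberPExp κP n) :
    MazurMainConjecture W 2 :=
  mazurMainConjecture_two_of_muIneqRel_of_classicalMu_cubicField_of_Δ_neg W h17 hGr hper hmod hGZK hI hord ht hΔ hr hμan hbsd hβ
    fun κP hκP => by
      obtain ⟨n, hn⟩ := hcert κP hκP
      exact classicalMuVanishes_adjoin_of_classNumberPExp_succ_eq W hord ht hβ κP hκP hn

/-- **THE RANK DOOR INTO `MC₂(W)` AT ANY LAYER PAIR.** Same with `rank₂ Cl(ℚ(β)_{n+1}) = rank₂ Cl(ℚ(β)_n)` for ONE `n ≥ 0` per cyclotomic `κP` — att-p4 g24's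
`…CubicRankDoorLayerOne.mazurMainConjecture_two_of_muIneqRel_of_classGroupPRank_succ_eq_of_one_le` with the restriction `1 ≤ n` removed.
[cite: Fukuda1994, Thm. 1 (2), p. 264] [cite: Kato2004Asterisque, Thm. 17.4 (1)(2) (p. 273)] [cite: GreenbergLNM1716, Thm. 4.1 (p. 102) and Conj. 1.11 (p. 58)]
[cite: Iwasawa1973MuInvariants, Thm. 2 and Thm. 3] -/
theorem mazurMainConjecture_two_of_muIneqRel_of_classGroupPRank_succ_eq
    (h17 : ∀ [NeZero (W.conductorNorm ℤ)] (f : CuspForm (Gamma0 (W.conductorNorm ℤ)) 2),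
      kato_divisibility_allPrimes W 2 (f := f))
    (hGr : Greenberg1999.thm41_charValue_rankZero_anyPrime)
    (hper : realPeriodRat_eq_unit_mul_plusPeriod_two) (hmod : nonempty_modularParametrizationData)
    (hGZK : rank_eq_analyticRank_of_analyticRank_le_one)
    (hI : ∀ (W : WeierstrassCurve ℚ) [W.IsElliptic] [W.IsGloballyMinimal], IsOrdinaryAt W 2 →
      (∀ x : ℚ, ¬ HasRationalTwoTorsionX W x) →
      ∀ (κ : ZpExtension ℚ 2) (γ : Field.absoluteGaloisGroup ℚ), κ.IsCyclotomic →
      κ.IsTopGenerator γ → IsCyclotomicVariable 2 γ →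
      ∀ ⦃N : ℕ⦄ [NeZero N] (f : CuspForm (Gamma0 N) 2), IsNewformOf W f →
      ∀ Gp : IwasawaAlgebra 2, iwasawaToPowerSeries 2 Gp = padicLFunction f (unitRoot W 2 : ℚ_[2]) →
      ∀ (D : W.SelmerDualData κ γ) (Yr : W.FineSelmerDualDataRelaxedInf κ γ),
        lengthAt (IwasawaAlgebra 2) D.X ⟨IwasawaAlgebra.augIdealP 2, IwasawaAlgebra.isPrime_augIdealP_holds 2⟩ ≤
          lengthAt (IwasawaAlgebra 2) (IwasawaAlgebra 2 ⧸ Ideal.span {Gp})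
              ⟨IwasawaAlgebra.augIdealP 2, IwasawaAlgebra.isPrime_augIdealP_holds 2⟩ +
            lengthAt (IwasawaAlgebra 2) Yr.X ⟨IwasawaAlgebra.augIdealP 2, IwasawaAlgebra.isPrime_augIdealP_holds 2⟩)
    (hord : IsOrdinaryAt W 2) (ht : ∀ x : ℚ, ¬ HasRationalTwoTorsionX W x) (hΔ : W.Δ < 0) (hr : W.analyticRank = 0)
    (hμan : ∀ ⦃N : ℕ⦄ [NeZero N] (f : CuspForm (Gamma0 N) 2), IsNewformOf W f →
      ∀ G : IwasawaAlgebra 2, IsEvenBranchLiftAtTwo W f G → red G ≠ 0)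
    (hbsd : BSDp W 2)
    {β : AlgebraicClosure ℚ} (hβ : aeval β W.twoTorsionPolynomial.toPoly = 0)
    (hcert : ∀ κP : ZpExtension ↥(IntermediateField.adjoin ℚ ({β} : Set (AlgebraicClosure ℚ))) 2, κP.IsCyclotomic →
      ∃ n : ℕ, classGroupPRank κP (n + 1) = classGroupPRank κP n) :
    MazurMainConjecture W 2 :=
  mazurMainConjecture_two_of_muIneqRel_of_classicalMu_cubicField_of_Δ_neg W h17 hGr hper hmod hGZK hI hord ht hΔ hr hμan hbsd hβ
    fun κP hκP => by
      obtain ⟨n, hn⟩ := hcert κP hκP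
      exact classicalMuVanishes_adjoin_of_classGroupPRank_succ_eq W hord ht hβ κP hκP hn

end Summit.BirchSwinnertonDyer.BirchSwinnertonDyer.Theorems.AlignedTransportAtTwoCubicOffStratumFukudaIndexDoors

end
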